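import Summits.HodgeConjecture.HodgeConjecture.Theses.CyclicUnitaryPowers
import Literature.AlgebraicGeometry.HodgeTheory.UnitaryCommutatorsIdentityComponent
import HarnessLib

/-!
# Crux K1 `VeryGeneralDeckCommutatorsInHg` (route `CyclicUnitaryPowers`, stmt-HodgeConjecture-19544), line
# `unitary-reflection-zariski` v9, lane D: the fact binder `stub_unitaryDense` LANDED as a theorem

The registered skeleton v9 of the crux (`Cruxes/VeryGeneralDeckCommutatorsInHg/Lines/unitary-reflection-zariski`,
planner P3 g23, 2026-08-27) binds the named fact
`Literature.AlgebraicGeometry.HodgeTheory.specialLinear_subset_glIdentityComponent_of_unitary_commutators`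
("a unitary group of a non-degenerate hermitian form is Zariski-dense in `GL_n(ℂ)`, hence a Zariski closure
containing the unitary commutators contains `SL_n(ℂ)` in its identity component" — hypothesis (1′) of Katz's
Goursat–Kolchin–Ribet criterion fed from Carlson–Toledo's density theorem, per eigenspace of the deck
transformation) as the stub `stub_unitaryDense`.  That fact is now a THEOREM of the tree
(`Literature/AlgebraicGeometry/HodgeTheory/UnitaryCommutatorsIdentityComponent.lean`,
`specialLinear_subset_glIdentityComponent_of_unitary_commutators_holds`, assembled from
`UnitaryGroupZariskiDense` (Cayley transform: `U(W,h)` is ℂ-Zariski dense in `GL(W)`),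
`GlZariskiClosureGroup` (commutators of closure points, Borel I.2.4), `SpecialLinearIdentityComponent`
(`(GL,GL) ⊇ SL`, and `SL ⊆ (Γ^Zar)°` by rootable generators) and `ZariskiClosureFiniteIndex` (the power map
is polynomial)).  This file records the stub BY NAME and signature, so the binder expires from the crux's
registry; the lane-D glue `stub_unitaryCommutatorsInMon_of_facts : CT71 → GKR' → UD → D` may now take `UD`
from here (or drop the antecedent).  Written by the prover seat `hodge-nonav-prover-A` (g2).
-/

-- `Summit.HodgeConjecture.HodgeConjecture.Theorems` is the mandated namespace (single-problem summit:
-- Problem = Summit), which `linter.dupNamespace` flags; the lakefile turns the linter off tree-wide (weak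
-- option), restated here so stand-alone elaboration is warning-free too.
set_option linter.dupNamespace false

namespace Summit.HodgeConjecture.HodgeConjecture.Theorems.CyclicUnitaryPowersUnitaryDense

/-- **Stub `stub_unitaryDense` of line `unitary-reflection-zariski` (v9) of crux K1
`VeryGeneralDeckCommutatorsInHg`, PROVED**: the named fact
`specialLinear_subset_glIdentityComponent_of_unitary_commutators` — for every finite-dimensional complex `W`
with a non-degenerate hermitian form and every `Γ ≤ GL(W)` whose Zariski closure contains the commutators of
the unitary group, every determinant-one automorphism lies in `glIdentityComponent Γ` — holds
(`specialLinear_subset_glIdentityComponent_of_unitary_commutators_holds`). [cite: Borel1991, I.2.2, I.2.4 and 18.3]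
[cite: Katz1990ESDE, §1.8 Prop. 1.8.2] -/
theorem stub_unitaryDense :
    Literature.AlgebraicGeometry.HodgeTheory.specialLinear_subset_glIdentityComponent_of_unitary_commutators :=
  Literature.AlgebraicGeometry.HodgeTheory.specialLinear_subset_glIdentityComponent_of_unitary_commutators_holds

end Summit.HodgeConjecture.HodgeConjecture.Theorems.CyclicUnitaryPowersUnitaryDense
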